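import Summits.ValiantsHypothesis.ValiantsHypothesis.Theses.SOSTau

/-!
# Disproof of `SOSTau` — findings (crux-disprover work file, cycle 1, 2026-08-17)

Crux: `Summit.ValiantsHypothesis.ValiantsHypothesis.Theses.SOSTau.SOSTau`
(item stmt-ValiantsHypothesis-18748, route route-ValiantsHypothesis-SOSTau) —
`∃ c : ℕ, ∀ s (a : Fin s → ℝ) (g : Fin s → ℝ[X]), #distinct real zeros of Σ C(aᵢ)·gᵢ² ≤ c·Σ|supp gᵢ|`
= Dutta 2021 Conj. 1 (SOS-τ) = Bürgisser 2024 Conj. 4.2, printed OPEN.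

VERDICT OF THIS CYCLE: **no kill**.  The typing is faithful (W.lean rc 0: `∃c ∀…` order as in
Bürgisser's restatement; `roots 0 = 0` supplies the printed guard `F ≠ 0`; distinct zeros via
`toFinset`; `c : ℕ` = ceiling of a real constant), so a refutation is a research result: an explicit
family of real weighted sparse sums of squares with (distinct real zeros)/(support-sum) → ∞.  None is
known in print (prior seats page-checked Dutta2021 §1.1/§8, Bürgisser2024 §4.6; this seat's searches
were service-degraded and found nothing new), and no construction of this seat beats the ratio 4.

INDEX (everything below is kernel-checked unless marked `sorry`; the landed copies live under
`Summits/…/Theorems/SOSTau/Negative/`):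

(a) LOAD-BEARING ANALYSIS — "any proof must use H":
  * realness — `sosTau_false_over_complex` : the verbatim complex analogue is false
    (`X^(2c+2) − 1 = (X^(c+1))² − 1²`, support-sum 2, 2c+2 distinct complex zeros).  Landed as
    `Negative/SOSTauFalseOverComplex.lean` (p159136).
  * support-SUM (vs support-UNION / Gram frame) — `sosTau_false_with_support_union` : charging a
    representation only for `|⋃ supp gᵢ|` is false (digit frame of size 2m carries every polynomial
    of degree < m² by polarised binomial squares; `∏_{k<m²−1}(X−k)`).  Landed as
    `Negative/SOSTauFalseWithSupportUnion.lean` (p159217).  MESSAGE TO PROVERS: a Gram-matrix /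
    quadratic-form approach must charge rank × sparsity of each square; the frame alone carries no
    bound at all.
  * distinctness of zeros — refuted earlier (`Negative/LoadBearing.lean`, p142891,
    `not_sosTau_with_multiplicity`: `X^(2c+2) = (X^(c+1))²`); `c ≠ 0` ibid.
  * hypotheses that are NOT load-bearing (no lemma, by inspection): nonnegativity of weights is not
    assumed (same-sign case is the trivial rung, support item SameSignSquares); `s` is not bounded
    (bounded `s` or bounded `max |supp gᵢ|` alone do not trivialise: Descartes gives `c = t+1` only
    for `|supp gᵢ| ≤ t`).

(b) TIGHTNESS — `four_mul_le_of_sosTauConst` : every admissible `c` has `4m ≤ c(m+2)` for all `m`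
    (Chebyshev doubling `T_{4m} = 2T_{2m}² − 1`, `|supp T_{2m}| ≤ m+1` by coefficient parity, `4m`
    distinct real zeros by Mathlib `roots_T_real`); hence `not_sosTau_const_three` and
    `four_le_of_sosTauConst` (= the body of support item ChebyshevCalibration, stmt-18755; attached
    there as a candidate proof for a prover).  Landed as `Negative/SOSTauChebyshevTight.lean`
    (p159260).  Ratio-4 families are ABUNDANT, not only Chebyshev: for ANY `R` with `t−1` distinct
    positive simple zeros, `R(x²)² − ε·x^{2j}` (two squares, support-sum `t+1`) has `4(t−1)` real
    zeros for small `ε > 0` (comment-level observation, §Near-misses).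

(c) NATURAL STRENGTHENINGS refuted: constant 3 (above); multiplicity (p142891); complex (above);
    union accounting (above).  NOT refuted, OPEN and the live target of any future disprover:
    `not_sosTau_const_four` (ratio > 4 at a single instance) — recorded with `sorry` in §Targets together
    with the EXACT SIEVES of this seat: reduction to even instances; `S ≤ 7` cannot beat `4S + 1` (Descartes
    on F + one Rolle division, exhaustive); `S = 8` reduces to 469 classes of "needles" `y^ε h² + b y^μ + c y^ν`
    (`|supp h| = 6`) where every inequality must be tight; two kit jobs (j025961, j026062) probe them.

(d) TARGETS — payload `targets`/`stuck_stubs` empty this cycle (no line picked yet).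

(e) NEAR-MISSES / WHY IT RESISTS — see the docstrings of §Near-misses: (1) two squares cap at
    `4S − 2` (Descartes on `g₁ ± g₂`), so `s ≥ 3` with mixed signs is forced, and `s = 3` contains
    Chattopadhyay's open `fg + 1` problem (`fg + 1 = ((f+g)/2)² − ((f−g)/2)² + 1²`); (2) compositions
    `P(T_m)`, `x ↦ x^N`, product-to-sum, Pell and Pythagorean identities never beat ratio 4
    (`deg P ≤ 2·max deg pᵢ`); (3) in the patchworked / tropical regime the count is
    `Z₊ ≤ 2·(#dips of the big square while uncovered) + (#crossings with the cover) ≤ 2S`, i.e. ratio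
    ≤ 4 — beating 4 needs several LACUNARY squares co-active in one archimedean window, cancelling
    like an identity yet oscillating; (4) perturbing an exact SOS identity `Σ aᵢgᵢ² ≡ 0` by
    `gᵢ → gᵢ + εwᵢ` gives to first order `2ε Σ aᵢgᵢwᵢ`, a sum of `s` products of sparse pairs, for
    which no superlinear real-zero construction is known either; (5) monomial counting: ratio > 4 needs
    `Σᵢ|Aᵢ+Aᵢ| > 2·Σ|Aᵢ| + 1`, so some square must have a support with large doubling (|A| ≥ 5 for
    `s = 3` with two monomial squares, |A₁|,|A₂| ≥ 4 otherwise) — every search cell with all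
    `|supp gᵢ| ≤ 3` was structurally incapable of ratio > 4, and for the first admissible shape
    `g² − b·x^{2μ} − c·x^{2ν}` Rolle on `(g/ψ)² − 1`, `ψ² = b x^{2μ} + c x^{2ν}`, gives
    `Z₊ ≤ 3|supp g| − 1`, which excludes the cell `(5,1,1)` (S = 7) for even instances.

Attack log (this seat): typing audit; literature (lit search local/openalex/s2/arxiv/zbmath, galaxy
×6 — degraded: searchd reset, OpenAlex budget exhausted, S2 429; zbMATH 6 generic rows; galaxy: CSR
2021 volume = Dutta2021, Koiran's Newton-polygon slides); paper constructions (list above); three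
negative lemmas + one tightness family landed; strategist's kit jobs j024936/j024937 (prescribed-roots
hyperbolicity search) not readable from this seat — their summaries attach to the item.
-/

set_option linter.dupNamespace false

namespace Summit.ValiantsHypothesis.ValiantsHypothesis.Cruxes.SOSTau.Disproof

open Polynomial Polynomial.Chebyshev Finset Real
open Summit.ValiantsHypothesis.ValiantsHypothesis.Theses.SOSTau (SOSTau)

/-! ## The crux with an explicit constant -/

/-- `SOSTau` with the constant made explicit. -/
def SOSTauConst (c : ℕ) : Prop :=
  ∀ (s : ℕ) (a : Fin s → ℝ) (g : Fin s → Polynomial ℝ),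
    (∑ i, Polynomial.C (a i) * g i ^ 2).roots.toFinset.card ≤ c * ∑ i, (g i).support.card

theorem sosTau_iff : SOSTau ↔ ∃ c, SOSTauConst c := Iff.rfl

theorem SOSTauConst.mono {c c' : ℕ} (h : SOSTauConst c) (hcc' : c ≤ c') : SOSTauConst c' :=
  fun s a g => (h s a g).trans (Nat.mul_le_mul_right _ hcc')

/-! ## (a) Load-bearing analysis -/

/-- `SOSTau` with `ℝ` replaced by `ℂ` throughout (the hypothesis "real" dropped). -/
def SOSTauWithoutReal : Prop :=
  ∃ c : ℕ, ∀ (s : ℕ) (a : Fin s → ℂ) (g : Fin s → Polynomial ℂ),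
    (∑ i, Polynomial.C (a i) * g i ^ 2).roots.toFinset.card ≤ c * ∑ i, (g i).support.card

/-- REALNESS IS LOAD-BEARING: the complex analogue is false.  Witness for a purported `c`:
`s = 2`, `a = (1,−1)`, `g = (X^(c+1), 1)`, `f = X^(2c+2) − 1` with `2c+2` distinct complex zeros and
support-sum `2`.  (Landed: `Negative/SOSTauFalseOverComplex.lean`.) [folklore] -/
theorem sosTau_false_without_real : ¬ SOSTauWithoutReal := by
  rintro ⟨c, hc⟩
  have h := hc 2 ![1, -1] ![X ^ (c + 1), 1]
  have hf : (∑ i : Fin 2, Polynomial.C ((![1, -1] : Fin 2 → ℂ) i) *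
      (![X ^ (c + 1), 1] : Fin 2 → ℂ[X]) i ^ 2) = X ^ (2 * c + 2) - Polynomial.C 1 := by
    simp only [Fin.sum_univ_two, Matrix.cons_val_zero, Matrix.cons_val_one, map_one, one_mul,
      one_pow, map_neg, mul_one, ← pow_mul]
    ring_nf
  have hS : (∑ i : Fin 2, ((![X ^ (c + 1), 1] : Fin 2 → ℂ[X]) i).support.card) = 2 := by
    simp only [Fin.sum_univ_two, Matrix.cons_val_zero, Matrix.cons_val_one]
    rw [Polynomial.support_X_pow, ← Polynomial.C_1, Polynomial.support_C (one_ne_zero)]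
    simp
  rw [hf, hS] at h
  have hroots : (X ^ (2 * c + 2) - Polynomial.C (1 : ℂ)).roots.toFinset.card = 2 * c + 2 := by
    classical
    have := IsPrimitiveRoot.card_nthRootsFinset
      (Complex.isPrimitiveRoot_exp (2 * c + 2) (by omega))
    rwa [Polynomial.nthRootsFinset_def] at this
  rw [hroots] at h
  omega

/-- `SOSTau` with the support-SUM weakened to the support-UNION (the size of the common monomial
frame of a Gram representation). -/
def SOSTauWithoutSum : Prop :=
  ∃ c : ℕ, ∀ (s : ℕ) (a : Fin s → ℝ) (g : Fin s → Polynomial ℝ),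
    (∑ i, Polynomial.C (a i) * g i ^ 2).roots.toFinset.card ≤
      c * (Finset.univ.biUnion fun i => (g i).support).card

/-- Polarisation with the weight carried by `C`. [folklore] -/
theorem C_mul_X_pow_mul_X_pow_eq_polarised (c : ℝ) (i j : ℕ) :
    Polynomial.C c * ((X : ℝ[X]) ^ i * X ^ j) = Polynomial.C (c * (1/4)) * (X ^ i + X ^ j) ^ 2
      + Polynomial.C (-(c * (1/4))) * (X ^ i - X ^ j) ^ 2 := by
  have h4 : Polynomial.C (1/4 : ℝ) * (4 : ℝ[X]) = 1 := by
    rw [← map_ofNat Polynomial.C 4, ← map_mul]; norm_num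
  simp only [map_mul, map_neg]
  linear_combination (-(Polynomial.C c * X ^ i * X ^ j)) * h4

/-- THE SUPPORT-SUM IS LOAD-BEARING: the union/frame accounting is false.  With the digit frame
`A = {0,…,m−1} ∪ m·{0,…,m−1}` (`|A| ≤ 2m`), `X^k = X^(k % m)·X^(m (k/m))` for `k < m²` is a weighted
difference of two binomial squares supported in `A`, so every polynomial of degree `< m²` is a
weighted SOS over the frame; `f = ∏_{k<m²−1}(X − k)` has `m² − 1` distinct real zeros.  Witness for a
purported `c`: `m = 2c + 2`.  (Landed: `Negative/SOSTauFalseWithSupportUnion.lean`.) [folklore] -/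
theorem sosTau_false_without_sum : ¬ SOSTauWithoutSum := by
  rintro ⟨c, hc⟩
  set m : ℕ := 2 * c + 2 with hm
  set D : ℕ := m ^ 2 - 1 with hD
  have hm0 : 0 < m := by omega
  have hDm : D < m ^ 2 := by
    have : 0 < m ^ 2 := by positivity
    omega
  set rs : Finset ℝ := (Finset.range D).image (fun k : ℕ => (k : ℝ)) with hrs
  set f : ℝ[X] := rs.prod (fun r => X - Polynomial.C r) with hf
  have hcard_rs : rs.card = D := by
    rw [hrs, Finset.card_image_of_injective _ Nat.cast_injective, Finset.card_range]
  have hroots : f.roots.toFinset.card = D := by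
    rw [hf, roots_prod_X_sub_C, Finset.val_toFinset, hcard_rs]
  have hdeg : f.natDegree < m ^ 2 := by
    rw [hf, natDegree_finsetProd_X_sub_C_eq_card, hcard_rs]; exact hDm
  let g₁ : Fin (m ^ 2) → ℝ[X] := fun k => X ^ ((k : ℕ) % m) + X ^ (m * ((k : ℕ) / m))
  let g₂ : Fin (m ^ 2) → ℝ[X] := fun k => X ^ ((k : ℕ) % m) - X ^ (m * ((k : ℕ) / m))
  let a₁ : Fin (m ^ 2) → ℝ := fun k => f.coeff k * (1/4)
  let a₂ : Fin (m ^ 2) → ℝ := fun k => -(f.coeff k * (1/4))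
  have h := hc (m ^ 2 + m ^ 2) (Fin.append a₁ a₂) (Fin.append g₁ g₂)
  have hrep : (∑ i, Polynomial.C (Fin.append a₁ a₂ i) * Fin.append g₁ g₂ i ^ 2) = f := by
    rw [Fin.sum_univ_add]
    simp only [Fin.append_left, Fin.append_right]
    rw [← Finset.sum_add_distrib]
    conv_rhs => rw [as_sum_range' f (m ^ 2) hdeg, ← Fin.sum_univ_eq_sum_range]
    refine Finset.sum_congr rfl fun k _ => ?_
    have hk : (X : ℝ[X]) ^ (k : ℕ) = X ^ ((k : ℕ) % m) * X ^ (m * ((k : ℕ) / m)) := by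
      rw [← pow_add, Nat.mod_add_div]
    rw [← C_mul_X_pow_eq_monomial, hk]
    simp only [a₁, a₂, g₁, g₂]
    exact (C_mul_X_pow_mul_X_pow_eq_polarised (f.coeff k) _ _).symm
  set A : Finset ℕ := Finset.range m ∪ (Finset.range m).image (fun j => m * j) with hA
  have hA_card : A.card ≤ m + m := by
    calc A.card ≤ (Finset.range m).card + ((Finset.range m).image (fun j => m * j)).card :=
          Finset.card_union_le _ _
      _ ≤ m + m := by
          rw [Finset.card_range]
          exact Nat.add_le_add_left (Finset.card_image_le.trans (by rw [Finset.card_range])) _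
  have hmem1 : ∀ k : Fin (m ^ 2), (k : ℕ) % m ∈ A := fun k => by
    rw [hA, Finset.mem_union]; left
    exact Finset.mem_range.mpr (Nat.mod_lt _ hm0)
  have hmem2 : ∀ k : Fin (m ^ 2), m * ((k : ℕ) / m) ∈ A := fun k => by
    rw [hA, Finset.mem_union]; right
    refine Finset.mem_image.mpr ⟨(k : ℕ) / m, Finset.mem_range.mpr ?_, rfl⟩
    exact Nat.div_lt_of_lt_mul (by rw [← sq]; exact k.isLt)
  have hU : (Finset.univ.biUnion fun i => (Fin.append g₁ g₂ i).support) ⊆ A := by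
    intro e he
    rw [Finset.mem_biUnion] at he
    obtain ⟨i, -, hi⟩ := he
    refine Fin.addCases (motive := fun i => e ∈ (Fin.append g₁ g₂ i).support → e ∈ A)
      (fun k hk => ?_) (fun k hk => ?_) i hi
    · rw [Fin.append_left] at hk
      have hk' := Polynomial.support_add hk
      rw [Finset.mem_union, Polynomial.support_X_pow, Polynomial.support_X_pow,
        Finset.mem_singleton, Finset.mem_singleton] at hk'
      rcases hk' with rfl | rfl
      exacts [hmem1 k, hmem2 k]
    · rw [Fin.append_right] at hk
      simp only [g₂, sub_eq_add_neg] at hk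
      have hk' := Polynomial.support_add hk
      rw [Finset.mem_union, Polynomial.support_neg, Polynomial.support_X_pow,
        Polynomial.support_X_pow, Finset.mem_singleton, Finset.mem_singleton] at hk'
      rcases hk' with rfl | rfl
      exacts [hmem1 k, hmem2 k]
  rw [hrep, hroots] at h
  have hle : D ≤ c * (m + m) :=
    h.trans (Nat.mul_le_mul_left c ((Finset.card_le_card hU).trans hA_card))
  rw [hD, hm] at hle
  have : (2 * c + 2) ^ 2 = c * (2 * c + 2 + (2 * c + 2)) + 4 * c + 4 := by ring
  omega

/-! ## (b) Tightness: the Chebyshev family, `c ≥ 4` -/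

/-- Parity of the Chebyshev coefficients: `coeff (T n) k = 0` whenever `n + k` is odd. [folklore] -/
theorem coeff_chebyshevT_eq_zero_of_odd_add :
    ∀ n k : ℕ, Odd (n + k) → (T ℝ n).coeff k = 0
  | 0, k, h => by
    rw [Nat.cast_zero, T_zero, coeff_one, if_neg]
    rintro rfl
    simp at h
  | 1, k, h => by
    rw [Nat.cast_one, T_one, coeff_X, if_neg]
    rintro rfl
    norm_num at h
  | n + 2, k, h => by
    have hc : ((n + 2 : ℕ) : ℤ) = (n : ℤ) + 2 := by push_cast; ring
    rw [hc, T_add_two, coeff_sub]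
    have h1 : ((n : ℤ) + 1) = ((n + 1 : ℕ) : ℤ) := by push_cast; ring
    rw [h1]
    cases k with
    | zero =>
      rw [mul_assoc, mul_comm, coeff_mul_ofNat, coeff_X_mul_zero, zero_mul, zero_sub,
        neg_eq_zero]
      exact coeff_chebyshevT_eq_zero_of_odd_add n 0 (by simpa [Nat.odd_add] using h)
    | succ j =>
      rw [mul_assoc, mul_comm, coeff_mul_ofNat, coeff_X_mul,
        coeff_chebyshevT_eq_zero_of_odd_add (n + 1) j ?_,
        coeff_chebyshevT_eq_zero_of_odd_add n (j + 1) ?_]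
      · simp
      · have : n + 2 + (j + 1) = (n + (j + 1)) + 2 := by ring
        rw [this, Nat.odd_add] at h
        simpa using h
      · have : n + 2 + (j + 1) = (n + 1 + j) + 2 := by ring
        rw [this, Nat.odd_add] at h
        simpa using h

/-- `T_{2m}` is even of degree `2m`: at most `m + 1` monomials. [folklore] -/
theorem card_support_chebyshevT_two_mul_le (m : ℕ) :
    (T ℝ ((2 * m : ℕ) : ℤ)).support.card ≤ m + 1 := by
  have hsub : (T ℝ ((2 * m : ℕ) : ℤ)).support ⊆ (Finset.range (m + 1)).image (fun j => 2 * j) := by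
    intro k hk
    rw [mem_support_iff] at hk
    have hk_le : k ≤ 2 * m := by
      have := le_natDegree_of_ne_zero hk
      rwa [natDegree_T, Int.natAbs_natCast] at this
    have hk_even : Even k := by
      by_contra hodd
      rw [Nat.not_even_iff_odd] at hodd
      exact hk (coeff_chebyshevT_eq_zero_of_odd_add (2 * m) k (by
        rw [Nat.odd_add']
        exact iff_of_true hodd (even_two_mul m)))
    obtain ⟨j, rfl⟩ := hk_even
    exact Finset.mem_image.mpr ⟨j, Finset.mem_range.mpr (by omega), by ring⟩
  calc (T ℝ ((2 * m : ℕ) : ℤ)).support.card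
      ≤ ((Finset.range (m + 1)).image (fun j => 2 * j)).card := Finset.card_le_card hsub
    _ ≤ (Finset.range (m + 1)).card := Finset.card_image_le
    _ = m + 1 := Finset.card_range _

/-- `T_n` has exactly `n` distinct real zeros. [folklore] -/
theorem card_roots_toFinset_chebyshevT (n : ℕ) : (T ℝ (n : ℤ)).roots.toFinset.card = n := by
  rw [roots_T_real, Finset.val_toFinset,
    Finset.card_image_of_injOn
      ((Finset.range _).nodup_map_iff_injOn.mp (roots_T_real_nodup _)),
    Finset.card_range]

/-- `T_{4m} = 2·T_{2m}² + (−1)·1²`. [folklore] -/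
theorem chebyshevT_four_mul_eq_sos (m : ℕ) :
    (∑ i : Fin 2, Polynomial.C ((![2, -1] : Fin 2 → ℝ) i) *
        (![T ℝ ((2 * m : ℕ) : ℤ), 1] : Fin 2 → ℝ[X]) i ^ 2) = T ℝ ((4 * m : ℕ) : ℤ) := by
  have h4 : ((4 * m : ℕ) : ℤ) = 2 * ((2 * m : ℕ) : ℤ) := by push_cast; ring
  rw [h4, T_mul, T_two]
  simp only [Fin.sum_univ_two, Matrix.cons_val_zero, Matrix.cons_val_one, one_pow, mul_one,
    sub_comp, mul_comp, pow_comp, X_comp, one_comp, ofNat_comp, map_neg, map_one]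
  rw [map_ofNat Polynomial.C 2]
  push_cast
  ring

/-- Support-sum of the Chebyshev representation is `≤ m + 2`. [folklore] -/
theorem supportSum_chebyshev_sos_le (m : ℕ) :
    (∑ i : Fin 2, ((![T ℝ ((2 * m : ℕ) : ℤ), 1] : Fin 2 → ℝ[X]) i).support.card) ≤ m + 2 := by
  simp only [Fin.sum_univ_two, Matrix.cons_val_zero, Matrix.cons_val_one]
  have h1 : (1 : ℝ[X]).support.card ≤ 1 := by
    rw [← Polynomial.C_1]
    exact (Finset.card_le_card (Polynomial.support_C_subset (1 : ℝ))).trans (by simp)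
  have := card_support_chebyshevT_two_mul_le m
  omega

/-- TIGHTNESS AT CHEBYSHEV: `4m ≤ c·(m+2)` for every admissible constant and every `m`
(ratio → 4).  (Landed: `Negative/SOSTauChebyshevTight.lean`.) [folklore] -/
theorem sosTau_tight_at_chebyshev {c : ℕ} (hc : SOSTauConst c) (m : ℕ) : 4 * m ≤ c * (m + 2) := by
  have h := hc 2 ![2, -1] ![T ℝ ((2 * m : ℕ) : ℤ), 1]
  rw [chebyshevT_four_mul_eq_sos, card_roots_toFinset_chebyshevT] at h
  exact h.trans (Nat.mul_le_mul_left c (supportSum_chebyshev_sos_le m))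

/-- (c) The strengthening "constant 3" is FALSE (`T₂₈ = 2T₁₄² − 1`: 28 zeros, support-sum 9). -/
theorem not_sosTau_const_three : ¬ SOSTauConst 3 := by
  intro h3
  have := sosTau_tight_at_chebyshev h3 7
  omega

/-- Every admissible constant is at least `4` (= body of support item ChebyshevCalibration; a
candidate proof is attached to stmt-ValiantsHypothesis-18755 for a prover). [folklore] -/
theorem four_le_of_sosTauConst {c : ℕ} (hc : SOSTauConst c) : 4 ≤ c := by
  have := sosTau_tight_at_chebyshev hc 9
  omega

/-! ## (c) Targets / the live natural strengthening: can the constant 4 be beaten at all?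

REDUCTION TO EVEN INSTANCES.  If some instance has `Z ≥ 4S + 2` distinct real zeros then `max(Z₊, Z₋) ≥ 2S + 1`
and `x ↦ f(±x²)` is an EVEN instance with the same support-sum and `Z ≥ 4S + 2`; so (up to the single value
`Z = 4S + 1`, which needs `Z₊ = Z₋ = 2S` and `f(0) = 0`) it suffices to study even `f`, i.e. `gᵢ = x^{εᵢ} hᵢ(x²)`,
`F(y) = Σ aᵢ y^{εᵢ} hᵢ(y)²`, and to ask for `P := #{distinct positive roots of F} ≥ 2S + 1`.

EXACT SIEVES RUN BY THIS SEAT (scripts + JSON in the seat folder `compute/`, pure combinatorics, exhaustive):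
* `hypcells3.py` — HYPERBOLIC even witnesses (`P = deg F`, all coefficients of `F` nonzero and alternating):
  necessary conditions (coverage of `[0, D]` by `⋃(Aᵢ+Aᵢ+εᵢ)`, cancellability above `D`, GF(2) sign-feasibility
  with mixed weights).  Result: `S ≤ 7`: NO cell admissible (monomial count / coverage); `S = 8`: only the shape
  `(6,1,1)` (one 6-sparse square + two monomial squares); `S = 9`: `(7,1,1), (6,2,1), (6,1,1,1), (5,3,1), (5,2,2),
  (4,4,1)` admissible, `(5,2,1,1)` and everything with all `Tᵢ ≤ 4` except `(4,4,1)` not.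
* `needles_t11.py` — the cells `(T,1,1)`: `F = y^ε h² + b y^μ + c y^ν`.  ROLLE BOUND (proved on paper, two lines):
  on the region where `m := −(b y^μ + c y^ν)` (or its positive part) is `> 0`, the zeros of `F` are those of
  `G = y^ε h²/m − 1`, whose critical points are the zeros of `h` (≤ `V(h)` ≤ T−1) and of the `2T`-nomial
  `N = Σ_e h_e [(E_e − μ)|b| y^{e+μ} ± (E_e − ν)|c| y^{e+ν}]`, `E_e = 2e + ε` (≤ `V(N)` ≤ 2T−1); hence
  `P ≤ V(h) + V(N) + 1 ≤ 3T − 1`.  Combined with Descartes on `F` (forced signs at uniquely represented exponents)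
  and the term count, exhaustively over `A ⊂ [0,13]` (T = 6) / `[0,11]` (T = 7), all `μ ≠ ν ≤ 2H+6`, all sign cases:
  - `S = 7`, `(5,1,1)`: `P ≤ 14 < 15` — EXCLUDED outright (so `Z ≤ 4S + 1 = 29` for every instance with `S ≤ 7`
    up to the parity caveat above; in fact `S ≤ 6` is excluded by monomial counting alone).
  - `S = 8`, `(6,1,1)`: `P ≤ 17 = 2S+1` and equality needs EVERYTHING tight: `h` fully sign-alternating with 5
    positive zeros (Descartes-sharp), `N` with all 12 monomials alternating and 11 positive zeros, perfect
    interlacing; 7090 sign-admissible configurations `(A, ε, μ, ν, signs)` ("needles"), 2170 with `0 ∈ A`, in 469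
    structural classes — typically one monomial INSIDE the degree range of the square and one ABOVE it
    (`ν > 2·max A + ε`), mixed signs, e.g. `A = {0,1,2,5,9,10}, ε = 0, F = h² − βy¹⁶ − γy²²`.  Hump accounting for
    that example: `h′` has no spare critical point, so the inner humps of `|h|` give ≤ 2 crossings each unless `N`
    spends ≥ 3 zeros there; the budget `11` forces e.g. `8` crossings on `(y₅, ∞)` where `h` is monotone — i.e.
    `h/(y⁸√(β+γy⁶))` must oscillate around `±1` eight times beyond the last zero of `h`.  Not excluded on paper.
  - `S = 9`, `(7,1,1)`: `P ≤ 20`; 10802 needles (8520 with `0 ∈ A`, 567 classes).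
* NUMERICS (kit, ONE batched job each, summaries attach to the item): `j025961` "ratio4hunt" — Nelder–Mead/Powell
  multistart hyperbolicity pursuit over sanity cells (two squares: must reproduce the ratio-4 family), all
  hypcells3-admissible patterns at `S = 8, 9` × sign patterns, and random cells at `S = 10..14`; `j026062`
  "needlehunt" — 400 representative Rolle-needles (`S = 8`: 230, `S = 9`: 170) with the sieve's forced sign
  patterns, surrogate `Σ_roots min(√(|arg ρ|/π), ¼ + √((π−|arg ρ|)/π))`, `(b,c)` log-grid refinement, mpmath
  sign-change recount.  RESULTS: pending at this revision (see the item's evidence `compute-j025961.json`,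
  `compute-j026062.json`; numbers are folded into this block when read).
MESSAGE TO PROVERS: the data so far say the conjecture may well hold with the SHARP constant `Z ≤ 4S + O(1)`
(Chebyshev gives `4S − 8`; nothing found above `4S`); the first place where the elementary tools (Descartes on `F`,
one Rolle division) stop deciding is `S = 8`, one 6-sparse square against two monomials.
-/

/-- OPEN (the live target for a disprover; NOT a claim): is the constant `4` itself refutable, i.e.
is there ONE real weighted sparse SOS with more than `4·S` distinct real zeros?  No instance is known;
Chebyshev gives exactly `4S − 8`; all kit searches of earlier seats (j022989, j023021, j023251) stayed
below ratio 2 except by construction; see the cell analysis above for where to look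
(`S ≥ 8`, one square with `|supp| ≥ 5` of large doubling, three mixed-sign squares, one archimedean
window).  A proof of THIS statement would not refute the crux (only `c = 4`), but would kill the
"Chebyshev-sharp" form `Z ≤ 4S` and the strategist's rigidity form `deg F + 2 ≤ 2S` for one-signed
rooted sparse SOS (through `y = x²`). -/
theorem not_sosTau_const_four : ¬ SOSTauConst 4 := by
  sorry

/-! ## (e) Near-misses and why the crux resists (documentation by example)

1. Two squares never beat 4: `a₁g₁² + a₂g₂²` with `a₁a₂ < 0` factors as `a₁(g₁ − γg₂)(g₁ + γg₂)`,
   each factor `(T₁+T₂)`-sparse, so `Z ≤ 2(2(T₁+T₂) − 1) = 4S − 2` (Dutta2021 Thm 9 = support item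
   TwoSquares).  Chebyshev attains `4S − 8`.  So every counterexample has `s ≥ 3`, mixed signs.
2. `s = 3` mixed = `±(|h|² − g²)` with `h = g₁ + i g₂ ∈ ℂ[x]`: real zeros = real points where the
   sparse complex curve `x ↦ h(x)/g(x)` meets the unit circle; contains `fg + 1 = ((f+g)/2)² −
   ((f−g)/2)² + 1²` (Chattopadhyay's open problem: is `Z(fg+1)` linear in the sparsity?).  A kill of
   the crux at `s = 3` would in particular settle that problem negatively — research-grade.
3. Compositions cap at 4: `f = P(T_m)` with `P = Σ aᵢpᵢ²` costs `S ≈ (m/2)·Σ deg pᵢ ≥ (m/2)·(deg P)/2`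
   for `Z ≤ m·deg P` zeros; same for `x ↦ x^N`, `T_m ∘ g`, `2T_aT_b = T_{a+b} + T_{a−b}`, Pell
   `T_m² − (x²−1)U_{m−1}² = 1` and Pythagorean `(α²−β²)² + (2αβ)² = (α²+β²)²` perturbed inside the class.
4. Tropical regime caps at 4: if the monomials of the big square `g` are patchworked (one or two
   dominant at every scale), `|g|` has ≤ T−1 dips and its envelope is convex-PL in `u = log x`; a cover
   `ψ² = Σⱼ bⱼx^{2μⱼ}` (log-convex, `m` pieces) crosses the envelope ≤ 2m times, so
   `Z₊ ≤ 2(T−1) + 2m ≤ 2S`.  More generally zeros only occur at near-ties of the top two square-monomials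
   (birth skeleton `stub_dominantNoZero`), and the doubly-tropical count is `≤ S` (strategist D2).  A
   counterexample must therefore be ARCHIMEDEAN: several lacunary squares comparable on one window.
5. Ratio-4 families are abundant (so "rigidity at ratio 4 forces Chebyshev" is FALSE as a heuristic):
   for any real-rooted `R` with `t−1` simple positive zeros, `F = R(x²)² − ε x^{2j}` =
   `(R(x²) − √ε x^j)(R(x²) + √ε x^j)` has `4(t−1)` simple real zeros for small `ε`, support-sum `t+1`.
6. Perturbation of identities is first-order ΣΠ: `Σaᵢ(gᵢ+εwᵢ)² = 2εΣaᵢgᵢwᵢ + O(ε²)` when `Σaᵢgᵢ² ≡ 0`;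
   real zeros of `Σ_{i≤s} gᵢwᵢ` (sums of products of sparse pairs) — no superlinear family known
   (Koiran–Portier–Tavenas 2015 give only `t^{O(s²)}`-type UPPER bounds).
-/

end Summit.ValiantsHypothesis.ValiantsHypothesis.Cruxes.SOSTau.Disproof
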